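import Summits.QuantumFields.YangMills.Theorems.UnitScaleTiltProp7TubeComparisonRowFlat
import Summits.QuantumFields.YangMills.Theorems.UnitScaleTiltProp7QTwSScalarSectorRegPr
import Summits.QuantumFields.YangMills.Theorems.UnitScaleTiltProp7SkewSplitFrobeniusRow
import HarnessLib

/-!
# Route `UnitScaleTilt`, crux «MinimiserStabilityRegPr» (stmt-QuantumFields-19200), stub `stub_existenceMinimalOrbit` (EX), pen (b1) —
# **THE SCALAR ROW OF THE TUBE COMPARISON IS AN IDENTITY AT EVERY PRINTED-REGULAR BACKGROUND**:
# `T^{str}_W(s·1)(bondShift c') = ℓ^d • QTwS W (s·1) c'` (transports act trivially on scalars; print's averaging of a scalar field is the flat mean).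

Cell `ym3-torus`, twin-width seat `ym-ust-19200-w7` (gen 10).  THEOREMS ONLY (0 `def`, 0 `sorry`); `--supports stmt-QuantumFields-19200 --as helper`, count-neutral.
YM₃ on T³ is ladder rung R3 — NOT d = 4, NOT infinite volume, NOT a mass gap, NOT Clay; nothing here claims a print row, the stub or the crux.

THE ROW `hrow1` OF ✓`Prop7TraceSplitFrobeniusRow.skewRow_of_traceless_row_of_scalar_row` (the iℝ·1 ∕ ℂ·1 sector of the (b1) comparison), BY NAME: `conjR u (s·1) = s·1` (✓`Prop7DeltaEtaCurrentNormLowerBound.conjR_smul_one`'s one-liner, inlined), so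
`T^{str}_W(s·1) = T^{str}_1(s·1)` (§1); ✓`Prop7TubeComparisonRowFlat.tubeStr_one_eq_smul_QTwS_one` (`T^{str}_1 Y(bondShift c') = ℓ^d • QTwS 1 Y c'`); ✓`Prop7SymAvgTwSym.QTwS_apply_smul_one_of_regPr`
(the closed, background-independent form of `QTwS W (s·1)` at `RegPr`, `10¹²L³ε₀ ≤ 1`) through ✓`QTwS_smul_one_eq_QTwS_one_of_regPr` (`QTwS W (s·1) = QTwS 1 (s·1)`).  Hence (§2) the EXACT identity
`Σ_c‖T^{str}_W(s·1)(c)‖_F² = (ℓ^d)²·Σ_{c'}‖QTwS W (s·1) c'‖_F²` and the row with any `½CT ≥ 1`, any slack `β ≥ 0`.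
[Balaban1984PropagatorsI] (1.18) p.20; [Balaban1985Variational] (51) p.286; [Balaban1985BackgroundPropagators] (3.14)–(3.15) p.393.
-/

set_option autoImplicit false

noncomputable section

open scoped BigOperators Matrix.Norms.L2Operator Matrix InnerProductSpace

namespace Summit.QuantumFields.YangMills.Theorems.Prop7TubeComparisonScalarRow

open Literature.MathematicalPhysics.QuantumFieldTheory.Balaban1983to89
open Finset B1RG242Torus
open B7Prop1Explicit (treeWord)
open B7Eq78Linearization (conjR conjR_apply)
open B10Eq27TorusAxialLog (holT unitsField toUField)
open T3ContinuumYM3Torus (T3Family)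
open T3LevelShift (bondShift)
open T3PrintedRegularOrbits (sites_eq)
open T3PrintedRegularMinimiser (RegPr)
open Summit.QuantumFields.YangMills.Theorems.Prop7SectET3HilbertLetters (W₂ frobEquiv)
open Summit.QuantumFields.YangMills.Theorems.Prop7SymAvgTwSym (QTwS QTwS_apply_smul_one_of_regPr QTwS_smul_one_eq_QTwS_one_of_regPr)
open Summit.QuantumFields.YangMills.Theorems.Prop7TubeComparisonRowFlat (tubeStr_one_eq_smul_QTwS_one)

variable (F : T3Family) (n K : ℕ)

/-! ## §1 Transports act trivially on scalar fields -/

/-- ★ **THE CORNER TUBE OF A SCALAR FIELD DOES NOT SEE THE BACKGROUND**: `T^{str}_W(s·1)(c) = (Σ_{tube(c)} s)·1` for every `W`.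
[cite: Balaban1984PropagatorsI, (1.18) p.20] -/
theorem tubeStr_smul_one (W : GaugeField (F.P K) 0 (Matrix.specialUnitaryGroup (Fin 2) ℂ)) (s : PBond (F.P K) 0 → ℂ) (c : PBond (F.P K) (K - n)) :
    (∑ r : Fin (F.P K).d → Fin ((F.P K).L ^ (K - n)), ∑ t ∈ range ((F.P K).L ^ (K - n)),
        conjR (holT (unitsField (toUField W)) (Site.fibreSite 0 (K - n) c.src fun _ => ⟨0, pow_pos (F.P K).L_pos (K - n)⟩)
              (treeWord fun ν => ((r ν : ℕ) : ℤ))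
            * holT (unitsField (toUField W)) (Site.fibreSite 0 (K - n) c.src r) (List.replicate t (c.dir, true)))
          ((fun b => s b • (1 : Matrix (Fin 2) (Fin 2) ℂ)) ⟨(fun z : Site (F.P K) 0 => z.shift c.dir)^[t] (Site.fibreSite 0 (K - n) c.src r), c.dir⟩))
      = (∑ r : Fin (F.P K).d → Fin ((F.P K).L ^ (K - n)), ∑ t ∈ range ((F.P K).L ^ (K - n)),
          s ⟨(fun z : Site (F.P K) 0 => z.shift c.dir)^[t] (Site.fibreSite 0 (K - n) c.src r), c.dir⟩) • (1 : Matrix (Fin 2) (Fin 2) ℂ) := by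
  rw [Finset.sum_smul]
  refine Finset.sum_congr rfl fun r _ => ?_
  rw [Finset.sum_smul]
  exact Finset.sum_congr rfl fun t _ => by rw [conjR_apply, Matrix.mul_smul, Matrix.mul_one, Matrix.smul_mul, Units.mul_inv]

variable (h : n ≤ K)

/-- ★★★ **THE SCALAR SECTOR OF THE TUBE COMPARISON IS EXACT**: `T^{str}_W(s·1)(bondShift c') = ℓ^d • QTwS W (s·1) c'` at every printed-regular `W`.
[cite: Balaban1984PropagatorsI, (1.18) p.20; Balaban1985Variational, (51) p.286] -/
theorem tubeStr_smul_one_eq_smul_QTwS {ε₀ : ℝ} (hε₀ : 0 < ε₀) (hWε : 10 ^ 12 * (F.L : ℝ) ^ 3 * ε₀ ≤ 1)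
    (W : GaugeField (F.P K) 0 (Matrix.specialUnitaryGroup (Fin 2) ℂ)) (hreg : RegPr F n K ε₀ W) (s : PBond (F.P K) 0 → ℂ) (c : PBond (F.P n) 0) :
    (∑ r : Fin (F.P K).d → Fin ((F.P K).L ^ (K - n)), ∑ t ∈ range ((F.P K).L ^ (K - n)),
        conjR (holT (unitsField (toUField W)) (Site.fibreSite 0 (K - n) (bondShift (sites_eq F n K h) c).src fun _ => ⟨0, pow_pos (F.P K).L_pos (K - n)⟩)
              (treeWord fun ν => ((r ν : ℕ) : ℤ))
            * holT (unitsField (toUField W)) (Site.fibreSite 0 (K - n) (bondShift (sites_eq F n K h) c).src r)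
                (List.replicate t ((bondShift (sites_eq F n K h) c).dir, true)))
          ((fun b => s b • (1 : Matrix (Fin 2) (Fin 2) ℂ)) ⟨(fun z : Site (F.P K) 0 => z.shift (bondShift (sites_eq F n K h) c).dir)^[t]
              (Site.fibreSite 0 (K - n) (bondShift (sites_eq F n K h) c).src r), (bondShift (sites_eq F n K h) c).dir⟩))
      = (((((F.P K).L : ℂ) ^ (K - n)) ^ (F.P K).d)) • QTwS F n K h W (fun b => s b • (1 : Matrix (Fin 2) (Fin 2) ℂ)) c := by
  rw [tubeStr_smul_one F n K W s, ← tubeStr_smul_one F n K 1 s, tubeStr_one_eq_smul_QTwS_one F n K h (fun b => s b • (1 : Matrix (Fin 2) (Fin 2) ℂ)) c,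
    QTwS_smul_one_eq_QTwS_one_of_regPr F h hε₀ hWε W hreg s]

/-! ## §2 The scalar row -/

/-- ★★★ **THE SCALAR ROW, EXACT**: `Σ_c‖T^{str}_W(s·1)(c)‖_F² = ((L^{K−n})^d)²·Σ_{c'}‖QTwS W (s·1) c'‖_F²` at `RegPr F n K ε₀ W` (`10¹²L³ε₀ ≤ 1`), for every complex scalar field `s`.
[cite: Balaban1984PropagatorsI, (1.18) p.20; Balaban1985Variational, (51) p.286] -/
theorem sum_normSq_frob_tubeStr_smul_one_eq {ε₀ : ℝ} (hε₀ : 0 < ε₀) (hWε : 10 ^ 12 * (F.L : ℝ) ^ 3 * ε₀ ≤ 1)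
    (W : GaugeField (F.P K) 0 (Matrix.specialUnitaryGroup (Fin 2) ℂ)) (hreg : RegPr F n K ε₀ W) (s : PBond (F.P K) 0 → ℂ) :
    ∑ c : PBond (F.P K) (K - n), ‖(frobEquiv.symm (∑ r : Fin (F.P K).d → Fin ((F.P K).L ^ (K - n)), ∑ t ∈ range ((F.P K).L ^ (K - n)),
        conjR (holT (unitsField (toUField W)) (Site.fibreSite 0 (K - n) c.src fun _ => ⟨0, pow_pos (F.P K).L_pos (K - n)⟩)
              (treeWord fun ν => ((r ν : ℕ) : ℤ))
            * holT (unitsField (toUField W)) (Site.fibreSite 0 (K - n) c.src r) (List.replicate t (c.dir, true)))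
          ((fun b => s b • (1 : Matrix (Fin 2) (Fin 2) ℂ)) ⟨(fun z : Site (F.P K) 0 => z.shift c.dir)^[t] (Site.fibreSite 0 (K - n) c.src r), c.dir⟩)) : W₂)‖ ^ 2
      = (((F.L : ℝ) ^ (K - n)) ^ (F.P K).d) ^ 2
          * ∑ c' : PBond (F.P n) 0, ‖(frobEquiv.symm (QTwS F n K h W (fun b => s b • (1 : Matrix (Fin 2) (Fin 2) ℂ)) c') : W₂)‖ ^ 2 := by
  classical
  have hL : ((F.P K).L : ℂ) = ((F.L : ℝ) : ℂ) := by norm_cast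
  have hℓ : (0 : ℝ) ≤ ((F.L : ℝ) ^ (K - n)) ^ (F.P K).d := by positivity
  -- re-index the coarse bonds of `P K` at level `K − n` by the fine bonds of `P n` (the level shift)
  have hs := Equiv.sum_comp (bondShift (sites_eq F n K h)) (fun cc : PBond (F.P K) (K - n) =>
    ‖(frobEquiv.symm (∑ r : Fin (F.P K).d → Fin ((F.P K).L ^ (K - n)), ∑ t ∈ range ((F.P K).L ^ (K - n)),
        conjR (holT (unitsField (toUField W)) (Site.fibreSite 0 (K - n) cc.src fun _ => ⟨0, pow_pos (F.P K).L_pos (K - n)⟩)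
              (treeWord fun ν => ((r ν : ℕ) : ℤ))
            * holT (unitsField (toUField W)) (Site.fibreSite 0 (K - n) cc.src r) (List.replicate t (cc.dir, true)))
          ((fun b => s b • (1 : Matrix (Fin 2) (Fin 2) ℂ)) ⟨(fun z : Site (F.P K) 0 => z.shift cc.dir)^[t] (Site.fibreSite 0 (K - n) cc.src r), cc.dir⟩)) : W₂)‖ ^ 2)
  refine hs.symm.trans ?_
  rw [Finset.mul_sum]
  refine Finset.sum_congr rfl fun c _ => ?_
  dsimp only
  rw [tubeStr_smul_one_eq_smul_QTwS F n K h hε₀ hWε W hreg s c, map_smul, norm_smul, mul_pow, hL]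
  congr 1
  rw [← Complex.ofReal_pow, ← Complex.ofReal_pow, Complex.norm_real, Real.norm_of_nonneg hℓ]

/-- ★★ **THE SCALAR ROW IN THE GLUE's SHAPE** (`hrow1` of ✓`Prop7TraceSplitFrobeniusRow.skewRow_of_traceless_row_of_scalar_row` with `T := T^{str}_W`, `Q := QTwS W`): for any
`½CT ≥ 1` and any slack `0 ≤ β`, `Σ_c‖T^{str}_W(s·1)(c)‖_F² ≤ ½CT·(ℓ^d)²·Σ_{c'}‖QTwS W (s·1) c'‖_F² + β·Σ_b‖s b·1‖_F²`.
[cite: Balaban1984PropagatorsI, (1.18) p.20; Balaban1985Variational, (51) p.286] -/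
theorem scalarRow_of_regPr {ε₀ : ℝ} (hε₀ : 0 < ε₀) (hWε : 10 ^ 12 * (F.L : ℝ) ^ 3 * ε₀ ≤ 1)
    (W : GaugeField (F.P K) 0 (Matrix.specialUnitaryGroup (Fin 2) ℂ)) (hreg : RegPr F n K ε₀ W) {CT β : ℝ} (hCT : 2 ≤ CT) (hβ : 0 ≤ β)
    (s : PBond (F.P K) 0 → ℂ) :
    ∑ c : PBond (F.P K) (K - n), ‖(frobEquiv.symm (∑ r : Fin (F.P K).d → Fin ((F.P K).L ^ (K - n)), ∑ t ∈ range ((F.P K).L ^ (K - n)),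
        conjR (holT (unitsField (toUField W)) (Site.fibreSite 0 (K - n) c.src fun _ => ⟨0, pow_pos (F.P K).L_pos (K - n)⟩)
              (treeWord fun ν => ((r ν : ℕ) : ℤ))
            * holT (unitsField (toUField W)) (Site.fibreSite 0 (K - n) c.src r) (List.replicate t (c.dir, true)))
          ((fun b => s b • (1 : Matrix (Fin 2) (Fin 2) ℂ)) ⟨(fun z : Site (F.P K) 0 => z.shift c.dir)^[t] (Site.fibreSite 0 (K - n) c.src r), c.dir⟩)) : W₂)‖ ^ 2
      ≤ (2⁻¹ * CT * (((F.L : ℝ) ^ (K - n)) ^ (F.P K).d) ^ 2)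
            * ∑ c' : PBond (F.P n) 0, ‖(frobEquiv.symm (QTwS F n K h W (fun b => s b • (1 : Matrix (Fin 2) (Fin 2) ℂ)) c') : W₂)‖ ^ 2
        + β * ∑ b : PBond (F.P K) 0, ‖(frobEquiv.symm (s b • (1 : Matrix (Fin 2) (Fin 2) ℂ)) : W₂)‖ ^ 2 := by
  rw [sum_normSq_frob_tubeStr_smul_one_eq F n K h hε₀ hWε W hreg s]
  have hQ : 0 ≤ ∑ c' : PBond (F.P n) 0, ‖(frobEquiv.symm (QTwS F n K h W (fun b => s b • (1 : Matrix (Fin 2) (Fin 2) ℂ)) c') : W₂)‖ ^ 2 := by positivity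
  have hS : 0 ≤ ∑ b : PBond (F.P K) 0, ‖(frobEquiv.symm (s b • (1 : Matrix (Fin 2) (Fin 2) ℂ)) : W₂)‖ ^ 2 := by positivity
  have hl : 0 ≤ (((F.L : ℝ) ^ (K - n)) ^ (F.P K).d) ^ 2 := sq_nonneg _
  have h1 : (((F.L : ℝ) ^ (K - n)) ^ (F.P K).d) ^ 2 ≤ 2⁻¹ * CT * (((F.L : ℝ) ^ (K - n)) ^ (F.P K).d) ^ 2 := by nlinarith
  nlinarith [mul_le_mul_of_nonneg_right h1 hQ, mul_nonneg hβ hS]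

end Summit.QuantumFields.YangMills.Theorems.Prop7TubeComparisonScalarRow

end
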